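import Mathlib
import Summits.Ventures.PercRepro2.TypedFactor
import Summits.Ventures.PercRepro2.TypedSepThreeSym
import Summits.Ventures.PercRepro2.TypedSplit
import Summits.Ventures.PercRepro2.TypedUntouched
import Summits.Ventures.PercRepro2.HCovTyped
import Summits.Ventures.PercRepro2.OStarGlueSum
import Summits.Ventures.PercRepro2.TwoMarkHubSum

/-!
# The gluing lemma for a two-mark hub (blind cell PercRepro2, mine-2 g40, 2026-08-28;
`proofs/MINE2-HUBK5.md` §2, row M2-85 — part III)

On the support of a typed count `K₃` is a SIDE KERNEL (`K3_eq_side`: `KB` on the glued states,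
the `A`-side the typed hub edges, the `B`-side the rest; `TwoMarkHubConn.lean`), which may be
symmetrised over the `B`-copies (p3's `six_mul_typedCount_sideB`, giving `PSYM`: `symB_Φ`); with
the product of the typed triples of the two sides (g39's `typedCount_eq_sum_AB`) and the
placement sum of the hub (`typedCount_hub_eq`, `TwoMarkHubSum.lean`): **`six_mul_typedCount_eq`**
— SIX TIMES THE TYPED COUNT IS THE SUM, OVER THE TYPED TRIPLES OF THE REST, OF THE GADGET SUM
`C h t` AT THE REST'S PATTERN TRIPLE, the typing `t` of the seven slots read off `F, z, τ`
(`typOf`).  The certificate `0 ≤ C` comes from `K₅` (`TwoMarkHubK5.lean`); the class theorems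
are in `TwoMarkHubMain.lean`.  Own code; standard axioms.
-/

namespace Summit.Ventures.PercRepro2

open UnionCluster

namespace CovForm

namespace THub

open OneTyped Untouched OStar K5 TypedFactor SepThree TypedRed

/-! ## `K₃` on the support is a side kernel -/

section Side

variable {V : Type*} {E : Type*} [DecidableEq V] [DecidableEq E]
variable (ends : E → Sym2 V) (o a₁ a₂ a₃ b : V) (h : HubType) (slot : Fin 7 → Option E)
  {R : Type*} [Field R]

/-- The kernel on the side restrictions: `KB` on the glued states. -/
noncomputable def Φ : Config E → Config E → Config E → Config E → Config E → Config E → R :=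
  fun xa ya wa xb yb wb =>
    ((KB (S h (pat ends o a₁ a₂ a₃ b h xb) (nbr slot xa))
      (S h (pat ends o a₁ a₂ a₃ b h yb) (nbr slot ya))
      (S h (pat ends o a₁ a₂ a₃ b h wb) (nbr slot wa)) : ℤ) : R)

variable {ends o a₁ a₂ a₃ b h slot}

/-- **`K₃` on the support is the side kernel of `Φ`.** -/
theorem K3_eq_side (hH : IsHub ends o a₁ a₂ a₃ b h slot) (F : Finset E) (z : Config E)
    {x y w : Config E} (hx : ∀ e, e ∉ F → x e = z e) (hy : ∀ e, e ∉ F → y e = z e)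
    (hw : ∀ e, e ∉ F → w e = z e) :
    (K3 ends o a₁ a₂ a₃ b x y w : R) =
      sideKernel (sideA ends o a₁ a₂ a₃ b h F) (sideB ends o a₁ a₂ a₃ b h F) z
        (Φ ends o a₁ a₂ a₃ b h slot) x y w := by
  rw [K3_eq_KB, hH.st_eq_S x, hH.st_eq_S y, hH.st_eq_S w]
  unfold sideKernel Φ
  rw [nbr_restr_sideA hH hx, nbr_restr_sideA hH hy, nbr_restr_sideA hH hw, pat_restr_sideB hx,
    pat_restr_sideB hy, pat_restr_sideB hw]

omit [DecidableEq E] in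
/-- The `B`-symmetrisation of `Φ` is the pattern-symmetrised kernel `PSYM`. -/
lemma symB_Φ (xa ya wa xb yb wb : Config E) :
    symB (Φ ends o a₁ a₂ a₃ b h slot) xa ya wa xb yb wb =
      ((PSYM h (nbr slot xa) (nbr slot ya) (nbr slot wa) (pat ends o a₁ a₂ a₃ b h xb)
        (pat ends o a₁ a₂ a₃ b h yb) (pat ends o a₁ a₂ a₃ b h wb) : ℤ) : R) := by
  unfold symB Φ PSYM
  push_cast
  ring

end Side

/-! ## The gluing theorem -/

section Main

variable {V : Type*} {E : Type*} [Fintype E] [DecidableEq V] [DecidableEq E]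
variable {ends : E → Sym2 V} {o a₁ a₂ a₃ b : V} {h : HubType} {slot : Fin 7 → Option E}
  {R : Type*} [Field R]

/-- The typing of the seven slots read off a typed set, a pinning and a type map. -/
def typOf (slot : Fin 7 → Option E) (A : Finset E) (z : Config E) (τ : E → ℕ) : Fin 7 → ℕ :=
  fun i => typ (slot i) A z τ

omit [Fintype E] [DecidableEq V] in
/-- The cast of the gadget sum is the `plc` sum of the casts. -/
lemma cast_C (h : HubType) (t : Fin 7 → ℕ) (P₁ P₂ P₃ : Pat3) :
    ((C h t P₁ P₂ P₃ : ℤ) : R) =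
      ((plc (t 0)).map fun c₀ => ((plc (t 1)).map fun c₁ => ((plc (t 2)).map fun c₂ =>
        ((plc (t 3)).map fun c₃ => ((plc (t 4)).map fun c₄ => ((plc (t 5)).map fun c₅ =>
          ((plc (t 6)).map fun c₆ =>
            ((PSYM h (c₀.1, c₁.1, c₂.1, c₃.1, c₄.1, c₅.1, c₆.1)
              (c₀.2.1, c₁.2.1, c₂.2.1, c₃.2.1, c₄.2.1, c₅.2.1, c₆.2.1)
              (c₀.2.2, c₁.2.2, c₂.2.2, c₃.2.2, c₄.2.2, c₅.2.2, c₆.2.2) P₁ P₂ P₃ : ℤ) :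
                R)).sum).sum).sum).sum).sum).sum).sum := by
  simp only [C, Int.cast_list_sum, List.map_map, Function.comp_def]

omit [Fintype E] in
/-- The type of a slot is at most `3`. -/
lemma typ_le_three {F : Finset E} {z : Config E} {τ : E → ℕ} (hτ : ∀ e ∈ F, τ e = 1 ∨ τ e = 2)
    (s : Option E) : typ s (sideA ends o a₁ a₂ a₃ b h F) z τ ≤ 3 := by
  cases s with
  | none => exact Nat.zero_le 3
  | some e =>
    simp only [typ]
    split_ifs with h1 h2
    · rcases hτ e (mem_sideA.1 h1).1 with h | h <;> omega
    · exact le_refl 3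
    · exact Nat.zero_le 3

/-- **THE GLUING THEOREM**: six times the typed count of `K₃` is the sum, over the typed triples of
the rest, of the gadget sum of the hub's typing at the rest's pattern triple. -/
theorem six_mul_typedCount_eq (hH : IsHub ends o a₁ a₂ a₃ b h slot) (F : Finset E)
    (z : Config E) (τ : E → ℕ) :
    6 * typedCount F z τ (K3 ends o a₁ a₂ a₃ b : Config E → Config E → Config E → R) =
      ∑ xb : Config E, ∑ yb : Config E, ∑ wb : Config E,
        if cond (sideB ends o a₁ a₂ a₃ b h F) z τ xb yb wb then
          ((C h (typOf slot (sideA ends o a₁ a₂ a₃ b h F) z τ) (pat ends o a₁ a₂ a₃ b h xb)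
            (pat ends o a₁ a₂ a₃ b h yb) (pat ends o a₁ a₂ a₃ b h wb) : ℤ) : R)
        else 0 := by
  have hside : typedCount F z τ (K3 ends o a₁ a₂ a₃ b : Config E → Config E → Config E → R) =
      typedCount F z τ (sideKernel (sideA ends o a₁ a₂ a₃ b h F) (sideB ends o a₁ a₂ a₃ b h F) z
        (Φ ends o a₁ a₂ a₃ b h slot)) :=
    typedCount_congr_on_support F z τ fun x y w hc _ =>
      K3_eq_side hH F z (fun e he => (hc e he).1) (fun e he => (hc e he).2.1)
        (fun e he => (hc e he).2.2)
  rw [hside, six_mul_typedCount_sideB F (sideB_subset F) (disjoint_sideA_sideB F) z τ]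
  have hU := typedCount_eq_sum_AB (sideA ends o a₁ a₂ a₃ b h F) (sideB ends o a₁ a₂ a₃ b h F)
    (disjoint_sideA_sideB F) z τ
    (sideKernel (sideA ends o a₁ a₂ a₃ b h F) (sideB ends o a₁ a₂ a₃ b h F) z
      (symB (Φ (R := R) ends o a₁ a₂ a₃ b h slot)))
  rw [sideA_union_sideB] at hU
  rw [hU]
  refine Finset.sum_congr rfl fun xb _ => Finset.sum_congr rfl fun yb _ =>
    Finset.sum_congr rfl fun wb _ => ?_
  by_cases hB : cond (sideB ends o a₁ a₂ a₃ b h F) z τ xb yb wb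
  · rw [if_pos hB]
    have hinner : ∀ xa ya wa : Config E,
        (if cond (sideA ends o a₁ a₂ a₃ b h F) z τ xa ya wa ∧
            cond (sideB ends o a₁ a₂ a₃ b h F) z τ xb yb wb then
          sideKernel (sideA ends o a₁ a₂ a₃ b h F) (sideB ends o a₁ a₂ a₃ b h F) z
            (symB (Φ ends o a₁ a₂ a₃ b h slot))
            (merge (sideA ends o a₁ a₂ a₃ b h F) (sideB ends o a₁ a₂ a₃ b h F) z xa xb)
            (merge (sideA ends o a₁ a₂ a₃ b h F) (sideB ends o a₁ a₂ a₃ b h F) z ya yb)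
            (merge (sideA ends o a₁ a₂ a₃ b h F) (sideB ends o a₁ a₂ a₃ b h F) z wa wb) else 0) =
        if cond (sideA ends o a₁ a₂ a₃ b h F) z τ xa ya wa then
          ((PSYM h (nbr slot xa) (nbr slot ya) (nbr slot wa) (pat ends o a₁ a₂ a₃ b h xb)
            (pat ends o a₁ a₂ a₃ b h yb) (pat ends o a₁ a₂ a₃ b h wb) : ℤ) : R) else 0 := by
      intro xa ya wa
      by_cases hA : cond (sideA ends o a₁ a₂ a₃ b h F) z τ xa ya wa
      · rw [if_pos ⟨hA, hB⟩, if_pos hA]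
        unfold sideKernel
        rw [restr_merge_left (fun e he => (hA.1 e he).1),
          restr_merge_left (fun e he => (hA.1 e he).2.1),
          restr_merge_left (fun e he => (hA.1 e he).2.2),
          restr_merge_right (disjoint_sideA_sideB F) (fun e he => (hB.1 e he).1),
          restr_merge_right (disjoint_sideA_sideB F) (fun e he => (hB.1 e he).2.1),
          restr_merge_right (disjoint_sideA_sideB F) (fun e he => (hB.1 e he).2.2), symB_Φ]
      · rw [if_neg (fun h' => hA h'.1), if_neg hA]
    refine (Finset.sum_congr rfl fun xa _ => Finset.sum_congr rfl fun ya _ =>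
      Finset.sum_congr rfl fun wa _ => hinner xa ya wa).trans ?_
    rw [← typedCount_eq_sum_cond, typedCount_hub_eq hH (fun e he => (mem_sideA.1 he).2) z τ
      (fun N₁ N₂ N₃ => ((PSYM h N₁ N₂ N₃ (pat ends o a₁ a₂ a₃ b h xb) (pat ends o a₁ a₂ a₃ b h yb)
        (pat ends o a₁ a₂ a₃ b h wb) : ℤ) : R)), cast_C]
    rfl
  · rw [if_neg hB]
    refine Finset.sum_eq_zero fun xa _ => Finset.sum_eq_zero fun ya _ =>
      Finset.sum_eq_zero fun wa _ => ?_
    rw [if_neg (fun h' => hB h'.2)]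

end Main

end THub

end CovForm

end Summit.Ventures.PercRepro2
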